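import Literature.NumberTheory.EllipticCurves.Greenberg1999.EulerCharacteristicNumberField
import Literature.NumberTheory.EllipticCurves.IsogenyFrobeniusTraceProofs
import Literature.NumberTheory.EllipticCurves.BSDConductorProofs
import Literature.NumberTheory.EllipticCurves.BSDQuadraticDescentTorsionOddPartProofs
import HarnessLib

/-!
# Greenberg 1999 Thm. 4.1: the `F = ℚ` named fact follows from the number-field named fact (proofs only)

Theorems only (no `def`, no `sorry`, no new named fact). The tree carries Greenberg's
Euler-characteristic formula (R. Greenberg, *Iwasawa theory for elliptic curves*, LNM 1716 (1999),
Thm. 4.1, p. 102) twice: for `F = ℚ` in the `ℚ`-specific spelling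
(`Literature.NumberTheory.EllipticCurves.greenberg_charValue_rankZero`, `IwasawaLeadingTerm.lean`:
`W.frobeniusTrace p`, the reduction mod `p` of the global minimal model) and, verbatim over a number
field `F` (`Greenberg1999.thm41_charValue_rankZero_numberField`, `EulerCharacteristicNumberField.lean`:
`E.frobeniusTraceAt v`, `E.reductionAt v` for the places `v ∋ p`). This file proves that the
SECOND IMPLIES THE FIRST (`greenberg_charValue_rankZero_of_numberField`), so that consumers of either
spelling depend on ONE printed statement: for `F = ℚ` the only place containing `p` is
`v_p = primesEquiv⁻¹ p` (`natCast_mem_asIdeal_iff_eq_primesEquiv_symm`), good reduction transports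
(`hasGoodReductionAtPrime_iff_hasGoodReductionAt_ringOfIntegers`), `a_{v_p} = a_p`
(`frobeniusTraceAt_eq_frobeniusTrace`) and `#Ẽ_{v_p}(k_{v_p}) = #W̃(𝔽_p)`
(`natCard_point_reduction_minimal_baseChange`, Silverman VII.1.3(b)), hence equal `p`-primary parts
(`natCard_primaryComponent_eq_pow_padicValNat`). The normalisation `IsCyclotomicVariable p γ` of the
`ℚ`-fact is not needed by the `F`-fact and is simply dropped.
-/

set_option autoImplicit false

noncomputable section

open scoped Classical NumberField

open WeierstrassCurve IsDedekindDomain Rat.HeightOneSpectrum Literature.NumberTheory.EllipticCurves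

namespace Literature.NumberTheory.EllipticCurves.Greenberg1999

/-- **Greenberg's Thm. 4.1 for `F = ℚ` (`greenberg_charValue_rankZero`) from the number-field statement
(`thm41_charValue_rankZero_numberField`).** For `W/ℚ` globally minimal and `p` odd of good ordinary
reduction the set of places of `𝓞 ℚ` containing `p` is `{v_p}`, `W` has good ordinary reduction at
`v_p` with `a_{v_p} = a_p`, and `#Ẽ_{v_p}(k_{v_p})[p^∞] = #W̃(𝔽_p)[p^∞]` (the reduction of Mathlib's
chosen local minimal model vs the reduction mod `p` of the global minimal model — two minimal models,
Silverman VII.1.3(b)); the `F`-fact at `F = ℚ`, `E = W` then reads exactly as the `ℚ`-fact.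
[cite: GreenbergLNM1716, Thm. 4.1 (p. 102)] [cite: SilvermanAEC2009, Prop. VII.1.3(b)] -/
theorem greenberg_charValue_rankZero_of_numberField (h : thm41_charValue_rankZero_numberField) :
    greenberg_charValue_rankZero := by
  intro W _ _ p _ hp hgood hord κ γ hκ hγ _ D _ hX fE hfE hfin
  -- the place `v_p` of `𝓞 ℚ` above `p`
  set v : HeightOneSpectrum (𝓞 ℚ) := (primesEquiv (R := 𝓞 ℚ)).symm ⟨p, Fact.out⟩ with hv
  have hpv : ((p : ℕ) : 𝓞 ℚ) ∈ v.asIdeal :=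
    (natCast_mem_asIdeal_iff_eq_primesEquiv_symm v (Fact.out : p.Prime)).mpr hv
  have hS : {w : HeightOneSpectrum (𝓞 ℚ) | ((p : ℕ) : 𝓞 ℚ) ∈ w.asIdeal} = {v} := by
    ext w
    simp only [Set.mem_setOf_eq, Set.mem_singleton_iff]
    exact natCast_mem_asIdeal_iff_eq_primesEquiv_symm w (Fact.out : p.Prime)
  have hq : primesEquiv v = ⟨p, Fact.out⟩ := Equiv.apply_symm_apply _ _
  have hqp : ((primesEquiv v : Nat.Primes) : ℕ) = p := by rw [hq]
  -- good reduction at `v_p`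
  have hgood' : W.HasGoodReductionAt v := by
    refine (hasGoodReductionAtPrime_iff_hasGoodReductionAt_ringOfIntegers v W).mp ?_
    have key : ∀ (q : ℕ) (hq' : Fact q.Prime), q = p → W.HasGoodReductionAtPrime q := by
      rintro q hq' rfl
      exact hgood
    exact key _ _ hqp
  -- ordinary at `v_p`: `a_{v_p} = a_p`
  have hord' : ¬ (p : ℤ) ∣ W.frobeniusTraceAt v := by
    rw [frobeniusTraceAt_eq_frobeniusTrace, hqp]
    exact hord
  obtain ⟨u, hu⟩ := h.of_unique_prime W p hp v hS hgood' hord' κ γ hκ hγ D hX fE hfE hfin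
  refine ⟨u, ?_⟩
  -- `#Ẽ_{v_p}(k_{v_p})[p^∞] = #W̃(𝔽_p)[p^∞]`
  have hc : Nat.card (W.reductionAt v).toAffine.Point = reductionPointCount W p := by
    rw [← hqp]
    exact natCard_point_reduction_minimal_baseChange v W
  haveI : Finite (W.reductionAt v).toAffine.Point := by
    refine Nat.finite_of_card_ne_zero ?_
    rw [hc, reductionPointCount]
    exact Nat.card_pos.ne'
  have hprim : Nat.card (AddCommGroup.primaryComponent (W.reductionAt v).toAffine.Point p) =
      Nat.card (AddCommGroup.primaryComponent
        ((integralModelInt W).map (Int.castRingHom (ZMod p))).toAffine.Point p) := by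
    rw [natCard_primaryComponent_eq_pow_padicValNat, natCard_primaryComponent_eq_pow_padicValNat, hc,
      reductionPointCount]
  rw [hprim] at hu
  -- the `DecidableEq ℚ` instances hidden in `AddCommGroup (W.toAffine.Point)` differ
  -- (`Classical.propDecidable` in the `F`-general fact vs `instDecidableEqRat`): identify them
  have hdec : (fun a b : ℚ => Classical.propDecidable (a = b)) = instDecidableEqRat :=
    Subsingleton.elim _ _
  rw [hdec] at hu
  exact hu

end Literature.NumberTheory.EllipticCurves.Greenberg1999

end
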